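import Summits.Ventures.GridStability.Lyapunov.StructurePreservingPolytope
import HarnessLib

/-!
# GridStability/Lyapunov/PolytopeSectorBounds — one-variable real analysis for the «SP-RATE-POLYTOPE»
# route: confinement of a line angle by its branch energy; sector / Bregman / pairing-ratio bounds on an
# ASYMMETRIC interval `[ℓ, u] ∋ σ*` of Vu–Turitsyn's polytope interval from ENDPOINT inequalities only

Cell `gridfusion` (LADDER-GRIDFUSION), seat gridfusion-lyap-1 (g8), item «SP-RATE-POLYTOPE» (successor item
named by lyap-1 g7): the rate of MODEL MV-3 (`StructurePreservingRatePoincare.lean`, p550672) lives on the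
WINDOW `|σ| ≤ π/2`, where the uniform strict sector gain of [cite: VuTuritsyn2017, §IV-A] exists; on the
POLYTOPE `|σ + σ*| < π` of [cite: VuTuritsyn2016, §IV] (★ #91, `StructurePreservingPolytopeRoa.lean`) the
gain degenerates at the tight configuration, so a rate on `{V ≤ c} ∩ 𝒫` needs PER-EDGE constants on the
sub-interval of line angles the level allows. Notation: equilibrium angle `a = σ*` (`|a| ≤ π/2`), current
angle `y`, `Δ = y − a`, model-2's branch energy `U(y) = branchEnergy y a = (cos a − cos y) − (y − a)·sin a`
[cite: Padiyar2013, §3.2 eq (3.13)]. CONTENTS: `branchEnergy_mono_right/left` (`U' = sin y − sin a`);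
**`mem_Ioo_of_branchEnergy_le`** (CONFINEMENT: `|y + a| ≤ π`, `U(y) ≤ κ < U(ℓ), U(u)`, `ℓ ≤ a ≤ u` ⇒
`ℓ < y < u`); **`sector_ge_of_endpoints`** (for `−π ≤ ℓ ≤ a ≤ u ≤ π`, `m ≤ cos a` and the TWO endpoint
inequalities `m(u − a) ≤ sin u − sin a`, `m(a − ℓ) ≤ sin a − sin ℓ`: `mΔ² ≤ Δ(sin y − sin a)` on `[ℓ, u]`
— the defect is increasing where `cos y ≥ cos a ≥ m` and concave on `[0, π]`);
**`branchEnergy_ge_of_endpoints`** (`mΔ²/2 ≤ U` on `[ℓ, u]`); **`pairing_ge_mul_branchEnergy_of_endpoints`**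
(for `k ≤ 1`: `k·U ≤ Δ(sin y − sin a)` on `[ℓ, u]` as soon as it holds at `ℓ` and at `u` — the defect has
`F' ≥ 0` termwise while `|y| ≤ π/2` and `F'' = (2 − k)cos y − Δ sin y ≤ 0` beyond; the left side is the
right side of the mirrored branch). Downstream (`StructurePreservingPolytopeRate.lean`): `W ≥ m·Q` and
`Π ≥ k·W` on the polytope sublevel, hence `V̇_h ≤ −ρV_h` there. Pure real analysis; no definition, no named
fact, standard axioms. (VALIDATED float remark, `tools/rmono.py` of this seat: `Δ(sin y − sin a)/U → 2` at
`a`, `→ 0` at the tight points, and `≥ 1` until `U ≈ 0.84·vtGap(a)` — so `k = 1` holds on most levels.)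
-/

noncomputable section

open Set Real
open Summit.Ventures.GridStability.Models.StructurePreserving
open Summit.Ventures.GridStability.Models.StructurePreserving.Params
open Summit.Ventures.GridStability.Lyapunov.StructurePreserving (branchEnergy_neg_neg)

namespace Summit.Ventures.GridStability.Lyapunov.PolytopeSector

/-! ### 1. The branch energy is monotone on each side of the equilibrium angle; confinement -/

/-- `d/dy U(y) = sin y − sin a` for the branch energy `U(y) = (cos a − cos y) − (y − a) sin a`.
[folklore] -/
theorem hasDerivAt_branchEnergy (a τ : ℝ) :
    HasDerivAt (fun y => branchEnergy y a) (Real.sin τ - Real.sin a) τ := by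
  have h : HasDerivAt (fun y => Real.cos a - Real.cos y - (y - a) * Real.sin a)
      (0 - -Real.sin τ - 1 * Real.sin a) τ :=
    ((hasDerivAt_const τ (Real.cos a)).sub (Real.hasDerivAt_cos τ)).sub
      (((hasDerivAt_id' τ).sub_const a).mul_const (Real.sin a))
  exact h.congr_deriv (by ring)

/-- **`U` increases to the right of `a` up to the tight point**: for `|a| ≤ π/2` and
`a ≤ y ≤ z ≤ π − a`, `U(y) ≤ U(z)` (`U' = sin y − sin a ≥ 0` there). [folklore] -/
theorem branchEnergy_mono_right {a y z : ℝ} (ha : |a| ≤ π / 2) (hay : a ≤ y) (hyz : y ≤ z)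
    (hz : z + a ≤ π) : branchEnergy y a ≤ branchEnergy z a := by
  have hmono : MonotoneOn (fun τ => branchEnergy τ a) (Icc a (π - a)) := by
    refine monotoneOn_of_hasDerivWithinAt_nonneg (convex_Icc a (π - a))
      (f' := fun τ => Real.sin τ - Real.sin a)
      (fun τ _ => (hasDerivAt_branchEnergy a τ).continuousAt.continuousWithinAt)
      (fun τ _ => (hasDerivAt_branchEnergy a τ).hasDerivWithinAt) ?_
    intro τ hτ
    rw [interior_Icc] at hτ
    exact sin_sub_sin_nonneg_of_le ha hτ.1.le (by linarith [hτ.2])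
  exact hmono ⟨hay, by linarith⟩ ⟨hay.trans hyz, by linarith⟩ hyz

/-- **`U` increases to the left of `a` down to the tight point**: for `|a| ≤ π/2` and
`−π − a ≤ z ≤ y ≤ a`, `U(y) ≤ U(z)` (`U' = sin y − sin a ≤ 0` there). [folklore] -/
theorem branchEnergy_mono_left {a y z : ℝ} (ha : |a| ≤ π / 2) (hz : -π ≤ z + a) (hzy : z ≤ y)
    (hya : y ≤ a) : branchEnergy y a ≤ branchEnergy z a := by
  have hanti : AntitoneOn (fun τ => branchEnergy τ a) (Icc (-π - a) a) := by
    refine antitoneOn_of_hasDerivWithinAt_nonpos (convex_Icc (-π - a) a)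
      (f' := fun τ => Real.sin τ - Real.sin a)
      (fun τ _ => (hasDerivAt_branchEnergy a τ).continuousAt.continuousWithinAt)
      (fun τ _ => (hasDerivAt_branchEnergy a τ).hasDerivWithinAt) ?_
    intro τ hτ
    rw [interior_Icc] at hτ
    exact sin_sub_sin_nonpos_of_le ha hτ.2.le (by linarith [hτ.1])
  exact hanti ⟨by linarith, hzy.trans hya⟩ ⟨by linarith, hya⟩ hzy

/-- **Confinement of a line angle by its branch energy.** For `|a| ≤ π/2`, a current angle on the
closed polytope interval `|y + a| ≤ π` with `U(y) ≤ κ`, and test angles `ℓ ≤ a ≤ u` with `κ < U(ℓ)`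
and `κ < U(u)`: `ℓ < y < u` (`U` is monotone on each side of `a`). This is how a level `V ≤ c` of the
energy confines every coupled line angle (`b_e·U_e ≤ W ≤ V`). [folklore] -/
theorem mem_Ioo_of_branchEnergy_le {a y ℓ u κ : ℝ} (ha : |a| ≤ π / 2) (hy : |y + a| ≤ π)
    (hκ : branchEnergy y a ≤ κ) (hℓa : ℓ ≤ a) (hau : a ≤ u)
    (hℓ : κ < branchEnergy ℓ a) (hu : κ < branchEnergy u a) : ℓ < y ∧ y < u := by
  obtain ⟨hy1, hy2⟩ := abs_le.1 hy
  constructor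
  · by_contra h
    push Not at h
    have := branchEnergy_mono_left ha (by linarith) h hℓa
    linarith
  · by_contra h
    push Not at h
    have := branchEnergy_mono_right ha hau h (by linarith)
    linarith

/-! ### 2. The sector bound on `[ℓ, u]` from endpoint slopes -/

/-- `d/dy [(sin y − sin a) − m(y − a)] = cos y − m`. [folklore] -/
theorem hasDerivAt_secantDefect (a m τ : ℝ) :
    HasDerivAt (fun y => Real.sin y - Real.sin a - m * (y - a)) (Real.cos τ - m) τ := by
  exact (((Real.hasDerivAt_sin τ).sub_const (Real.sin a)).sub
    (((hasDerivAt_id' τ).sub_const a).const_mul m)).congr_deriv (by rw [mul_one])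

/-- **Secant slopes to the right of `a` are at least the endpoint slope.** For `−π ≤ a ≤ u ≤ π` and
`m ≤ cos a` with `m(u − a) ≤ sin u − sin a`: `m(y − a) ≤ sin y − sin a` for all `y ∈ [a, u]`. Proof:
`G = (sin y − sin a) − m(y − a)` vanishes at `a`; on `[a, 0]` it increases (`cos y ≥ cos a ≥ m`); on
`[max(a,0), u] ⊆ [0, π]` it is concave (`G'' = −sin y ≤ 0`), so it is at least `min(G(max(a,0)), G(u))
≥ 0`. [folklore] -/
theorem secant_ge_right {a u m : ℝ} (ha : -π ≤ a) (hu : u ≤ π) (hm : m ≤ Real.cos a)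
    (hend : m * (u - a) ≤ Real.sin u - Real.sin a) :
    ∀ y ∈ Icc a u, m * (y - a) ≤ Real.sin y - Real.sin a := by
  set G : ℝ → ℝ := fun y => Real.sin y - Real.sin a - m * (y - a) with hG
  have hder : ∀ τ, HasDerivAt G (Real.cos τ - m) τ := hasDerivAt_secantDefect a m
  have hGa : G a = 0 := by simp [hG]
  have hGu : 0 ≤ G u := by simp only [hG]; linarith
  -- region I: `G ≥ 0` on `[a, u] ∩ (−∞, 0]`
  have hI : ∀ y, a ≤ y → y ≤ u → y ≤ 0 → 0 ≤ G y := by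
    intro y hay _ hy0
    have hmono : MonotoneOn G (Icc a y) := by
      refine monotoneOn_of_hasDerivWithinAt_nonneg (convex_Icc a y) (f' := fun τ => Real.cos τ - m)
        (fun τ _ => (hder τ).continuousAt.continuousWithinAt)
        (fun τ _ => (hder τ).hasDerivWithinAt) ?_
      intro τ hτ
      rw [interior_Icc] at hτ
      have h1 : Real.cos (-a) ≤ Real.cos (-τ) :=
        Real.cos_le_cos_of_nonneg_of_le_pi (by linarith [hτ.2]) (by linarith) (by linarith [hτ.1])
      rw [Real.cos_neg, Real.cos_neg] at h1
      show 0 ≤ Real.cos τ - m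
      linarith
    have h := hmono ⟨le_rfl, hay⟩ ⟨hay, le_rfl⟩ hay
    rw [hGa] at h
    exact h
  intro y hy
  obtain ⟨hay, hyu⟩ := hy
  rcases le_or_gt y 0 with hy0 | hy0
  · have h := hI y hay hyu hy0
    simp only [hG] at h
    linarith
  · -- region II: concave on `[max(a,0), u]`
    set a' := max a 0 with ha'
    have ha'y : a' ≤ y := max_le hay hy0.le
    have ha'u : a' ≤ u := ha'y.trans hyu
    have hGa' : 0 ≤ G a' := by
      rcases le_total a 0 with h | h
      · rw [ha', max_eq_right h]
        exact hI 0 h (by linarith) le_rfl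
      · rw [ha', max_eq_left h, hGa]
    have hconc : ConcaveOn ℝ (Icc a' u) G := by
      refine concaveOn_of_hasDerivWithinAt2_nonpos (convex_Icc a' u)
        (f' := fun τ => Real.cos τ - m) (f'' := fun τ => -Real.sin τ)
        (fun τ _ => (hder τ).continuousAt.continuousWithinAt)
        (fun τ _ => (hder τ).hasDerivWithinAt)
        (fun τ _ => ((Real.hasDerivAt_cos τ).sub_const m).hasDerivWithinAt) ?_
      intro τ hτ
      rw [interior_Icc] at hτ
      have h0τ : 0 ≤ τ := le_trans (le_max_right a 0) hτ.1.le
      have := Real.sin_nonneg_of_nonneg_of_le_pi h0τ (by linarith [hτ.2])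
      linarith
    have hseg : y ∈ segment ℝ a' u := by
      rw [segment_eq_Icc ha'u]
      exact ⟨ha'y, hyu⟩
    have hmin := hconc.ge_on_segment (left_mem_Icc.2 ha'u) (right_mem_Icc.2 ha'u) hseg
    have h : 0 ≤ G y := le_trans (le_min hGa' hGu) hmin
    simp only [hG] at h
    linarith

/-- **Secant slopes to the left of `a`** (mirror image of `secant_ge_right` under
`(y, a) ↦ (−y, −a)`): for `−π ≤ ℓ ≤ a ≤ π`, `m ≤ cos a`, `m(a − ℓ) ≤ sin a − sin ℓ`:
`m(a − y) ≤ sin a − sin y` for all `y ∈ [ℓ, a]`. [folklore] -/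
theorem secant_ge_left {a ℓ m : ℝ} (ha : a ≤ π) (hℓ : -π ≤ ℓ) (hm : m ≤ Real.cos a)
    (hend : m * (a - ℓ) ≤ Real.sin a - Real.sin ℓ) :
    ∀ y ∈ Icc ℓ a, m * (a - y) ≤ Real.sin a - Real.sin y := by
  intro y hy
  obtain ⟨hℓy, hya⟩ := hy
  have hm' : m ≤ Real.cos (-a) := by rwa [Real.cos_neg]
  have hend' : m * (-ℓ - -a) ≤ Real.sin (-ℓ) - Real.sin (-a) := by
    rw [Real.sin_neg, Real.sin_neg]
    linarith
  have h := secant_ge_right (a := -a) (u := -ℓ) (m := m) (by linarith) (by linarith)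
    hm' hend' (-y) ⟨by linarith, by linarith⟩
  rw [Real.sin_neg, Real.sin_neg] at h
  linarith

/-- **Strict sector bound on `[ℓ, u]` from two endpoint slopes.** For `−π ≤ ℓ ≤ a ≤ u ≤ π`,
`m ≤ cos a`, `m(a − ℓ) ≤ sin a − sin ℓ` and `m(u − a) ≤ sin u − sin a`: for every `y ∈ [ℓ, u]`,
`m·(y − a)² ≤ (y − a)(sin y − sin a)` — the analogue, on an arbitrary sub-interval of the polytope
interval, of Vu–Turitsyn's window gain `g(σ*)·(δ − δ*)² ≤ (δ − δ*)(sin δ − sin δ*)`.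
[cite: VuTuritsyn2017, §IV-A (strict sector bound, window case)] -/
theorem sector_ge_of_endpoints {a ℓ u m : ℝ} (hℓ : -π ≤ ℓ) (hℓa : ℓ ≤ a) (hau : a ≤ u) (hu : u ≤ π)
    (hm : m ≤ Real.cos a) (hendℓ : m * (a - ℓ) ≤ Real.sin a - Real.sin ℓ)
    (hendu : m * (u - a) ≤ Real.sin u - Real.sin a) :
    ∀ y ∈ Icc ℓ u, m * (y - a) ^ 2 ≤ (y - a) * (Real.sin y - Real.sin a) := by
  intro y hy
  obtain ⟨hℓy, hyu⟩ := hy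
  rcases le_total a y with hay | hya
  · have h := secant_ge_right (by linarith) hu hm hendu y ⟨hay, hyu⟩
    have hΔ : 0 ≤ y - a := by linarith
    have := mul_le_mul_of_nonneg_left h hΔ
    nlinarith
  · have h := secant_ge_left (by linarith) hℓ hm hendℓ y ⟨hℓy, hya⟩
    have hΔ : 0 ≤ a - y := by linarith
    have := mul_le_mul_of_nonneg_left h hΔ
    nlinarith

/-- `d/dy [U(y) − (m/2)(y − a)²] = (sin y − sin a) − m(y − a)`. [folklore] -/
theorem hasDerivAt_bregmanDefect (a m τ : ℝ) :
    HasDerivAt (fun y => branchEnergy y a - m / 2 * (y - a) ^ 2)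
      ((Real.sin τ - Real.sin a) - m * (τ - a)) τ := by
  have h2 : HasDerivAt (fun y : ℝ => (y - a) ^ 2) (((2 : ℕ) : ℝ) * (τ - a) ^ (2 - 1) * 1) τ :=
    ((hasDerivAt_id' τ).sub_const a).pow 2
  have h := (hasDerivAt_branchEnergy a τ).sub (h2.const_mul (m / 2))
  refine h.congr_deriv ?_
  push_cast
  ring

/-- **Bregman lower bound on `[ℓ, u]`**: under the data of `sector_ge_of_endpoints`,
`(m/2)·(y − a)² ≤ U(y)` for every `y ∈ [ℓ, u]` (`H = U − (m/2)Δ²` vanishes at `a`, increases on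
`[a, u]` and decreases on `[ℓ, a]` by the secant bounds). With `m = g(θ)` on the window this is
model-2's `branchEnergy_ge_quadratic`. [folklore] -/
theorem branchEnergy_ge_of_endpoints {a ℓ u m : ℝ} (hℓ : -π ≤ ℓ) (hℓa : ℓ ≤ a) (hau : a ≤ u)
    (hu : u ≤ π) (hm : m ≤ Real.cos a) (hendℓ : m * (a - ℓ) ≤ Real.sin a - Real.sin ℓ)
    (hendu : m * (u - a) ≤ Real.sin u - Real.sin a) :
    ∀ y ∈ Icc ℓ u, m / 2 * (y - a) ^ 2 ≤ branchEnergy y a := by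
  set H : ℝ → ℝ := fun y => branchEnergy y a - m / 2 * (y - a) ^ 2 with hH
  have hder : ∀ τ, HasDerivAt H ((Real.sin τ - Real.sin a) - m * (τ - a)) τ :=
    hasDerivAt_bregmanDefect a m
  have hHa : H a = 0 := by simp [hH, branchEnergy]
  intro y hy
  obtain ⟨hℓy, hyu⟩ := hy
  rcases le_total a y with hay | hya
  · have hmono : MonotoneOn H (Icc a u) := by
      refine monotoneOn_of_hasDerivWithinAt_nonneg (convex_Icc a u)
        (f' := fun τ => (Real.sin τ - Real.sin a) - m * (τ - a))
        (fun τ _ => (hder τ).continuousAt.continuousWithinAt)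
        (fun τ _ => (hder τ).hasDerivWithinAt) ?_
      intro τ hτ
      rw [interior_Icc] at hτ
      have h := secant_ge_right (by linarith) hu hm hendu τ ⟨hτ.1.le, hτ.2.le⟩
      show 0 ≤ (Real.sin τ - Real.sin a) - m * (τ - a)
      linarith
    have h := hmono ⟨le_rfl, hau⟩ ⟨hay, hyu⟩ hay
    rw [hHa] at h
    simp only [hH] at h
    linarith
  · have hanti : AntitoneOn H (Icc ℓ a) := by
      refine antitoneOn_of_hasDerivWithinAt_nonpos (convex_Icc ℓ a)
        (f' := fun τ => (Real.sin τ - Real.sin a) - m * (τ - a))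
        (fun τ _ => (hder τ).continuousAt.continuousWithinAt)
        (fun τ _ => (hder τ).hasDerivWithinAt) ?_
      intro τ hτ
      rw [interior_Icc] at hτ
      have h := secant_ge_left (by linarith) hℓ hm hendℓ τ ⟨hτ.1.le, hτ.2.le⟩
      show (Real.sin τ - Real.sin a) - m * (τ - a) ≤ 0
      linarith
    have h := hanti ⟨hℓy, hya⟩ ⟨hℓa, le_rfl⟩ hya
    rw [hHa] at h
    simp only [hH] at h
    linarith

/-! ### 3. The pairing-to-Bregman ratio on `[ℓ, u]` from the endpoints -/

/-- `d/dy [Δ(sin y − sin a) − k·U(y)] = (sin y − sin a) + Δ cos y − k(sin y − sin a)`. [folklore] -/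
theorem hasDerivAt_pairingDefect (a k τ : ℝ) :
    HasDerivAt (fun y => (y - a) * (Real.sin y - Real.sin a) - k * branchEnergy y a)
      ((Real.sin τ - Real.sin a) + (τ - a) * Real.cos τ - k * (Real.sin τ - Real.sin a)) τ := by
  have h1 : HasDerivAt (fun y => (y - a) * (Real.sin y - Real.sin a))
      (1 * (Real.sin τ - Real.sin a) + (τ - a) * Real.cos τ) τ :=
    ((hasDerivAt_id' τ).sub_const a).mul ((Real.hasDerivAt_sin τ).sub_const (Real.sin a))
  have h := h1.sub ((hasDerivAt_branchEnergy a τ).const_mul k)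
  refine h.congr_deriv ?_
  ring

/-- The second derivative: `d/dy [(sin y − sin a) + Δ cos y − k(sin y − sin a)]
= (2 − k) cos y − Δ sin y`. [folklore] -/
theorem hasDerivAt_pairingDefect_deriv (a k τ : ℝ) :
    HasDerivAt (fun y => (Real.sin y - Real.sin a) + (y - a) * Real.cos y
        - k * (Real.sin y - Real.sin a))
      ((2 - k) * Real.cos τ - (τ - a) * Real.sin τ) τ := by
  have h1 := (Real.hasDerivAt_sin τ).sub_const (Real.sin a)
  have h2 : HasDerivAt (fun y => (y - a) * Real.cos y) (1 * Real.cos τ + (τ - a) * -Real.sin τ) τ :=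
    ((hasDerivAt_id' τ).sub_const a).mul (Real.hasDerivAt_cos τ)
  have h3 := ((Real.hasDerivAt_sin τ).sub_const (Real.sin a)).const_mul k
  have h := (h1.add h2).sub h3
  refine h.congr_deriv ?_
  ring

/-- **The pairing dominates `k` times the branch energy to the right of `a`, given the endpoint.**
For `|a| ≤ π/2`, `a ≤ u ≤ π`, `0 ≤ k ≤ 1` and `k·U(u) ≤ (u − a)(sin u − sin a)`:
`k·U(y) ≤ (y − a)(sin y − sin a)` for every `y ∈ [a, u]`. Proof: the defect
`F = Δ(sin y − sin a) − kU` vanishes at `a`; on `[a, π/2]`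
`F' = (1 − k)(sin y − sin a) + Δ cos y ≥ 0` termwise; on `[π/2, u] ⊆ [π/2, π]`
`F'' = (2 − k)cos y − Δ sin y ≤ 0`, so `F ≥ min(F(π/2), F(u)) ≥ 0`. [folklore] -/
theorem pairing_ge_mul_branchEnergy_right {a u k : ℝ} (ha1 : -(π / 2) ≤ a) (ha2 : a ≤ π / 2)
    (hu : u ≤ π) (hk1 : k ≤ 1)
    (hend : k * branchEnergy u a ≤ (u - a) * (Real.sin u - Real.sin a)) :
    ∀ y ∈ Icc a u, k * branchEnergy y a ≤ (y - a) * (Real.sin y - Real.sin a) := by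
  set F : ℝ → ℝ := fun y => (y - a) * (Real.sin y - Real.sin a) - k * branchEnergy y a with hF
  set F1 : ℝ → ℝ := fun y => (Real.sin y - Real.sin a) + (y - a) * Real.cos y
    - k * (Real.sin y - Real.sin a) with hF1
  have hder : ∀ τ, HasDerivAt F (F1 τ) τ := hasDerivAt_pairingDefect a k
  have hder2 : ∀ τ, HasDerivAt F1 ((2 - k) * Real.cos τ - (τ - a) * Real.sin τ) τ :=
    hasDerivAt_pairingDefect_deriv a k
  have hFa : F a = 0 := by simp [hF, branchEnergy]
  have hFu : 0 ≤ F u := by simp only [hF]; linarith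
  -- region I: `F ≥ 0` on `[a, u] ∩ (−∞, π/2]` (monotone)
  have hI : ∀ y, a ≤ y → y ≤ u → y ≤ π / 2 → 0 ≤ F y := by
    intro y hay _ hy2
    have hmono : MonotoneOn F (Icc a y) := by
      refine monotoneOn_of_hasDerivWithinAt_nonneg (convex_Icc a y) (f' := F1)
        (fun τ _ => (hder τ).continuousAt.continuousWithinAt)
        (fun τ _ => (hder τ).hasDerivWithinAt) ?_
      intro τ hτ
      rw [interior_Icc] at hτ
      have hsin : Real.sin a ≤ Real.sin τ :=
        Real.sin_le_sin_of_le_of_le_pi_div_two ha1 (by linarith [hτ.2]) hτ.1.le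
      have hcos : 0 ≤ Real.cos τ :=
        Real.cos_nonneg_of_neg_pi_div_two_le_of_le (by linarith [hτ.1]) (by linarith [hτ.2])
      have h1 : 0 ≤ (1 - k) * (Real.sin τ - Real.sin a) := mul_nonneg (by linarith) (by linarith)
      have h2 : 0 ≤ (τ - a) * Real.cos τ := mul_nonneg (by linarith [hτ.1]) hcos
      show 0 ≤ F1 τ
      simp only [hF1]
      linarith
    have h := hmono ⟨le_rfl, hay⟩ ⟨hay, le_rfl⟩ hay
    rw [hFa] at h
    exact h
  intro y hy
  obtain ⟨hay, hyu⟩ := hy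
  rcases le_or_gt y (π / 2) with hy2 | hy2
  · have h := hI y hay hyu hy2
    simp only [hF] at h
    linarith
  · -- region II: concave on `[π/2, u]`
    have hpu : π / 2 ≤ u := hy2.le.trans hyu
    have hFp : 0 ≤ F (π / 2) := hI (π / 2) ha2 hpu le_rfl
    have hconc : ConcaveOn ℝ (Icc (π / 2) u) F := by
      refine concaveOn_of_hasDerivWithinAt2_nonpos (convex_Icc (π / 2) u) (f' := F1)
        (f'' := fun τ => (2 - k) * Real.cos τ - (τ - a) * Real.sin τ)
        (fun τ _ => (hder τ).continuousAt.continuousWithinAt)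
        (fun τ _ => (hder τ).hasDerivWithinAt)
        (fun τ _ => (hder2 τ).hasDerivWithinAt) ?_
      intro τ hτ
      rw [interior_Icc] at hτ
      have hcos : Real.cos τ ≤ 0 :=
        Real.cos_nonpos_of_pi_div_two_le_of_le hτ.1.le (by linarith [hτ.2])
      have hsin : 0 ≤ Real.sin τ :=
        Real.sin_nonneg_of_nonneg_of_le_pi (by linarith [hτ.1, Real.pi_pos]) (by linarith [hτ.2])
      have h1 : 0 ≤ (2 - k) * -Real.cos τ := mul_nonneg (by linarith) (by linarith)
      have h2 : 0 ≤ (τ - a) * Real.sin τ := mul_nonneg (by linarith [hτ.1]) hsin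
      linarith
    have hseg : y ∈ segment ℝ (π / 2) u := by
      rw [segment_eq_Icc hpu]
      exact ⟨hy2.le, hyu⟩
    have hmin := hconc.ge_on_segment (left_mem_Icc.2 hpu) (right_mem_Icc.2 hpu) hseg
    have h : 0 ≤ F y := le_trans (le_min hFp hFu) hmin
    simp only [hF] at h
    linarith

/-- **The pairing dominates `k` times the branch energy to the left of `a`, given the endpoint**
(mirror image under `(y, a) ↦ (−y, −a)`, which preserves both sides: `branchEnergy_neg_neg`): for
`|a| ≤ π/2`, `−π ≤ ℓ ≤ a`, `0 ≤ k ≤ 1`, `k·U(ℓ) ≤ (ℓ − a)(sin ℓ − sin a)`: the same on `[ℓ, a]`.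
[folklore] -/
theorem pairing_ge_mul_branchEnergy_left {a ℓ k : ℝ} (ha1 : -(π / 2) ≤ a) (ha2 : a ≤ π / 2)
    (hℓ : -π ≤ ℓ) (hk1 : k ≤ 1)
    (hend : k * branchEnergy ℓ a ≤ (ℓ - a) * (Real.sin ℓ - Real.sin a)) :
    ∀ y ∈ Icc ℓ a, k * branchEnergy y a ≤ (y - a) * (Real.sin y - Real.sin a) := by
  intro y hy
  obtain ⟨hℓy, hya⟩ := hy
  have hend' : k * branchEnergy (-ℓ) (-a) ≤ (-ℓ - -a) * (Real.sin (-ℓ) - Real.sin (-a)) := by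
    rw [branchEnergy_neg_neg, Real.sin_neg, Real.sin_neg]
    have e : (-ℓ - -a) * (-Real.sin ℓ - -Real.sin a) = (ℓ - a) * (Real.sin ℓ - Real.sin a) := by ring
    rw [e]; exact hend
  have h := pairing_ge_mul_branchEnergy_right (a := -a) (u := -ℓ) (k := k) (by linarith)
    (by linarith) (by linarith) hk1 hend' (-y) ⟨by linarith, by linarith⟩
  rw [branchEnergy_neg_neg, Real.sin_neg, Real.sin_neg] at h
  have e : (-y - -a) * (-Real.sin y - -Real.sin a) = (y - a) * (Real.sin y - Real.sin a) := by ring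
  rwa [e] at h

/-- **Pairing-to-Bregman ratio on `[ℓ, u]` from the two endpoints.** For `|a| ≤ π/2`,
`−π ≤ ℓ ≤ a ≤ u ≤ π`, `0 ≤ k ≤ 1`, and the endpoint inequalities `k·U(ℓ) ≤ (ℓ − a)(sin ℓ − sin a)`,
`k·U(u) ≤ (u − a)(sin u − sin a)`: `k·U(y) ≤ (y − a)(sin y − sin a)` for every `y ∈ [ℓ, u]`. Summed
over the coupled pairs with weights `bᵢⱼ ≥ 0` this is `k·W ≤ Π` on the polytope sublevel — the strict
dissipation of the LFF member `V_h` in the line angles. [folklore] -/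
theorem pairing_ge_mul_branchEnergy_of_endpoints {a ℓ u k : ℝ} (ha : |a| ≤ π / 2) (hℓ : -π ≤ ℓ)
    (hu : u ≤ π) (hk1 : k ≤ 1)
    (hendℓ : k * branchEnergy ℓ a ≤ (ℓ - a) * (Real.sin ℓ - Real.sin a))
    (hendu : k * branchEnergy u a ≤ (u - a) * (Real.sin u - Real.sin a)) :
    ∀ y ∈ Icc ℓ u, k * branchEnergy y a ≤ (y - a) * (Real.sin y - Real.sin a) := by
  obtain ⟨ha1, ha2⟩ := abs_le.1 ha
  intro y hy
  obtain ⟨hℓy, hyu⟩ := hy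
  rcases le_total a y with hay | hya
  · exact pairing_ge_mul_branchEnergy_right ha1 ha2 hu hk1 hendu y ⟨hay, hyu⟩
  · exact pairing_ge_mul_branchEnergy_left ha1 ha2 hℓ hk1 hendℓ y ⟨hℓy, hya⟩

end Summit.Ventures.GridStability.Lyapunov.PolytopeSector

end
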